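import Mathlib
import Summits.KontsevichZagierPeriods.Zeta5Search.Elimination.ContiguousPartners
import Summits.KontsevichZagierPeriods.Zeta5Search.Elimination.ContiguousPartnersPolytope
import Summits.KontsevichZagierPeriods.Zeta5Search.WedgeDictionaryDiagonalShift
import HarnessLib

/-!
# ζ(5) search — class `elim`: THE DIAGONAL PARTNER GIVES BROWN–ZUDILIN'S ELIMINANT ON THE NOSE
# (cell `pub-zeta5`, fam-elim, E-L12; add-on to E-L10/E-L11 over the D2 lane's relation (DS))

HONEST FRAMING: systematic search; no irrationality claim unless certified.

OUR work (Summit side; `families/elim/FAMILY.md` §17.10).  E-L10 (`Elimination/ContiguousPartners.lean`) proved that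
inside the contiguous sub-class E0 the `ζ(3)`-eliminant of the dual Brown–Zudilin form `F̃₇(b) = Uζ(5) + Wζ(3) − V`
(`WedgeDictionary.vwp_decomposition`) with an up-partner `b + e_{i+1}`,

  `partnerElim b i = W(b+e_{i+1})·F̃₇(b) − W(b)·F̃₇(b+e_{i+1}) = Q_i(b)·ζ(5) − P_i(b)`,

is ONE real number for all seven admissible slots (`partnerElim_partner_independent`); E-L11 identified its minors with
the census's `CasoratianValuation.minorQ / minorPhat / casoratian`.  The D2 lane (gen-1 g14,
`WedgeDictionaryDiagonalShift.lean`) proved the DIAGONAL-SHIFT relation (DS): for the diagonal translate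
`b⁺ = dsShift b = (b₀ + 2; b₁ + 1, …, b₇ + 1)` — the parameter shape of the translated summand,
`R_{b⁺}(t) = (t+1)(t+b₀+3)·R_b(t+1)` — and every admissible slot,

  `X(b⁺) = X(b + e_{i+1}) − λ_i(b)·X(b)`,  `X ∈ {U, W, V}`,  `λ_i(b) = (b_{i+1}+1)(b₀−b_{i+1}+1)` (`dsLam`).

This file draws the consequence for the elimination class.  The diagonal partner `b⁺` is NOT a unit shift
(`b⁺ − b = (2; 1⁷)`), so it is a genuinely different pair of the class — the "aligned-recurrence" partner of the brief:
`F̃₇(b⁺)` is the same hypergeometric summand translated by one in the summation index.  Nevertheless, for every `b`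
in the box (`InBox b`) with `d(b) = dOf b ≥ 0` and any admissible slot `i < 7` (`b_{i+1} ≤ b₀`):

* `typeI_dsShift`, `det_typeI_diag_eq_zero` — the coefficient vector `v(b⁺) = (U, W, V)(b⁺)` equals
  `v(b + e_{i+1}) − λ_i • v(b)`, so it lies in the plane `Π(b)` of E-L10 (`det[v(b), v(b+e_{i+1}), v(b⁺)] = 0`);
* `diagMinorQ_eq`, `diagMinorPhat_eq`, `diagMinorP_eq` — the three `2 × 2` minors of the DIAGONAL pair `(b, b⁺)`
  ARE the minors `Q_i, P̂_i, P_i` of Brown–Zudilin's contiguous pair (determinant invariance under a column operation),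
  hence (`diag_minors_eq_cv`, `diag_minors_eq_cv_of_inPolytope`) the census's `minorQ b j / minorPhat b j / casoratian b j`
  in every direction `j ∈ [1,7]` on the polytope;
* `vwpDual_dsShift` — (DS) holds for the FORM itself: `F̃₇(b⁺) = F̃₇(b + e_{i+1}) − λ_i·F̃₇(b)` (three-term decomposition
  + (DS) for the three coefficients; no new analysis);
* `diagElim_eq_partnerElim`, `diagElim_eq`, `diagElim_eq_cv` — the diagonal `ζ(3)`-eliminant
  `diagElim b = W(b⁺)·F̃₇(b) − W(b)·F̃₇(b⁺)` IS `partnerElim b i = Q_i(b)ζ(5) − P_i(b)`, as a real number;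
* `dOf_dsShift`, `dOf_iterate_dsShift`, `diagElim_iterate_eq_partnerElim` — along the diagonal sequence
  `b, b⁺, b⁺⁺, …` (`d` drops by one per step) consecutive-term elimination at step `k ≤ d(b)` reproduces Brown–Zudilin's
  eliminant at the base point `dsShift^[k] b`: no new linear forms in `1, ζ(5)` arise this way.

Reading for the class (T4, structural; FAMILY.md §0 'E0 = W6'): gen-1's exact partner atlas found 'partner choice
immaterial' for partners `b + e` with `|e| ≤ 2` (same RATES); E-L10 made the seven unit up-shifts give the SAME NUMBER;
this file adds the diagonal partner to that list — by identity, not by a rate comparison.  What this is NOT: anything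
about sizes, denominators, valuations or irrationality; and the second diagonal translate `b⁺⁺` paired with `b` is NOT
covered (its coefficient vector involves the second shell `b + e_i + e_k`, outside `Π(b)` in general).
-/

noncomputable section

open Finset

namespace Summit.KontsevichZagierPeriods.Zeta5Search.Elimination

open Summit.KontsevichZagierPeriods.Zeta5Search.DualSeries (InBox)
open Summit.KontsevichZagierPeriods.Zeta5Search.WedgeDictionary
open Literature.NumberTheory.Irrationality.BrownZudilin2022 (vwpDual)
open Literature.NumberTheory.Transcendental (zetaValue)

/-! ### The diagonal step lowers the excess `d` by one -/

/-- `d(b⁺) = d(b) − 1`: the diagonal translate `(b₀+2; b₁+1, …, b₇+1)` has excess `3(b₀+2) − Σ(b_j+1) = d(b) − 1`. -/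
theorem dOf_dsShift (b : ℕ → ℤ) : dOf (dsShift b) = dOf b - 1 := by
  unfold dOf
  rw [sum_dsShift, dsShift_zero]
  ring

/-- Along the diagonal sequence the excess decreases linearly: `d(dsShift^[k] b) = d(b) − k`. -/
theorem dOf_iterate_dsShift (b : ℕ → ℤ) (k : ℕ) : dOf (dsShift^[k] b) = dOf b - k := by
  induction k with
  | zero => simp
  | succ k ih =>
    rw [Function.iterate_succ_apply', dOf_dsShift, ih]
    push_cast
    ring

/-- The diagonal sequence stays in the box. -/
theorem inBox_iterate_dsShift {b : ℕ → ℤ} (hb : InBox b) (k : ℕ) : InBox (dsShift^[k] b) := by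
  induction k with
  | zero => simpa using hb
  | succ k ih => rw [Function.iterate_succ_apply']; exact inBox_dsShift ih

/-- The leading entry along the diagonal sequence: `(dsShift^[k] b)₀ = b₀ + 2k`. -/
theorem iterate_dsShift_zero (b : ℕ → ℤ) (k : ℕ) : (dsShift^[k] b) 0 = b 0 + 2 * k := by
  induction k with
  | zero => simp
  | succ k ih => rw [Function.iterate_succ_apply', dsShift_zero, ih]; push_cast; ring

/-- The other entries along the diagonal sequence: `(dsShift^[k] b)_{j+1} = b_{j+1} + k`. -/
theorem iterate_dsShift_succ (b : ℕ → ℤ) (k j : ℕ) : (dsShift^[k] b) (j + 1) = b (j + 1) + k := by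
  induction k with
  | zero => simp
  | succ k ih => rw [Function.iterate_succ_apply', dsShift_succ, ih]; push_cast; ring

/-! ### The coefficient vector of the diagonal partner lies in the plane `Π(b)` -/

/-- Vector form of (DS): `v(b⁺) = v(b + e_{i+1}) − λ_i • v(b)` for every admissible slot. -/
theorem typeI_dsShift (b : ℕ → ℤ) (hb : InBox b) (hd : 0 ≤ dOf b) {i : ℕ} (hi : i ∈ range 7)
    (hli : b (i + 1) ≤ b 0) :
    typeI (dsShift b) = typeI (up b i) - dsLam b i • typeI b := by
  obtain ⟨hU, hW, hV⟩ := dictionary_dsShift b hb hd hi hli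
  ext j
  fin_cases j <;> simp [typeI, up, hU, hW, hV]

/-- `det[v(b), v(b+e_{i+1}), v(b⁺)] = 0`: the diagonal partner's coefficient vector lies in E-L10's plane `Π(b)`
through `v(b)` and `v(b + e_{i+1})`. -/
theorem det_typeI_diag_eq_zero (b : ℕ → ℤ) (hb : InBox b) (hd : 0 ≤ dOf b) {i : ℕ} (hi : i ∈ range 7)
    (hli : b (i + 1) ≤ b 0) :
    (Matrix.of ![typeI b, typeI (up b i), typeI (dsShift b)]).det = 0 := by
  obtain ⟨hU, hW, hV⟩ := dictionary_dsShift b hb hd hi hli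
  rw [Matrix.det_fin_three]
  simp only [Matrix.of_apply, Matrix.cons_val_zero, Matrix.cons_val_one, Matrix.cons_val_two,
    Matrix.head_cons, Matrix.tail_cons, typeI, up]
  rw [hU, hW, hV]
  ring

/-! ### The three minors of the diagonal pair are Brown–Zudilin's minors -/

/-- The `ζ(5)`-coefficient of the diagonal eliminant: `U(b)W(b⁺) − U(b⁺)W(b)`. -/
def diagMinorQ (b : ℕ → ℤ) : ℚ := coeffU b * coeffW (dsShift b) - coeffU (dsShift b) * coeffW b

/-- The `ζ(3)`-side companion minor of the diagonal pair: `U(b)V(b⁺) − U(b⁺)V(b)`. -/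
def diagMinorPhat (b : ℕ → ℤ) : ℚ := coeffU b * coeffV (dsShift b) - coeffU (dsShift b) * coeffV b

/-- The constant term of the diagonal eliminant: `W(b⁺)V(b) − W(b)V(b⁺)`. -/
def diagMinorP (b : ℕ → ℤ) : ℚ := coeffW (dsShift b) * coeffV b - coeffW b * coeffV (dsShift b)

/-- `U(b)W(b⁺) − U(b⁺)W(b) = Q_i(b)` for every admissible slot `i` (column operation `v(b⁺) ↦ v(b⁺) + λ_i v(b)`). -/
theorem diagMinorQ_eq (b : ℕ → ℤ) (hb : InBox b) (hd : 0 ≤ dOf b) {i : ℕ} (hi : i ∈ range 7)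
    (hli : b (i + 1) ≤ b 0) : diagMinorQ b = minorQ b i := by
  obtain ⟨hU, hW, -⟩ := dictionary_dsShift b hb hd hi hli
  unfold diagMinorQ minorQ up
  linear_combination coeffU b * hW - coeffW b * hU

/-- `U(b)V(b⁺) − U(b⁺)V(b) = P̂_i(b)`. -/
theorem diagMinorPhat_eq (b : ℕ → ℤ) (hb : InBox b) (hd : 0 ≤ dOf b) {i : ℕ} (hi : i ∈ range 7)
    (hli : b (i + 1) ≤ b 0) : diagMinorPhat b = minorPhat b i := by
  obtain ⟨hU, -, hV⟩ := dictionary_dsShift b hb hd hi hli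
  unfold diagMinorPhat minorPhat up
  linear_combination coeffU b * hV - coeffV b * hU

/-- `W(b⁺)V(b) − W(b)V(b⁺) = P_i(b)`. -/
theorem diagMinorP_eq (b : ℕ → ℤ) (hb : InBox b) (hd : 0 ≤ dOf b) {i : ℕ} (hi : i ∈ range 7)
    (hli : b (i + 1) ≤ b 0) : diagMinorP b = minorP b i := by
  obtain ⟨-, hW, hV⟩ := dictionary_dsShift b hb hd hi hli
  unfold diagMinorP minorP up
  linear_combination coeffV b * hW - coeffW b * hV

/-- The diagonal pair's minors over the census's objects: `diagMinorQ b = CasoratianValuation.minorQ b (i+1)`,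
`diagMinorPhat b = CasoratianValuation.minorPhat b (i+1)`, `diagMinorP b = CasoratianValuation.casoratian b (i+1)`
(E-L11's `rfl` bridges). -/
theorem diag_minors_eq_cv (b : ℕ → ℤ) (hb : InBox b) (hd : 0 ≤ dOf b) {i : ℕ} (hi : i ∈ range 7)
    (hli : b (i + 1) ≤ b 0) :
    diagMinorQ b = CasoratianValuation.minorQ b (i + 1) ∧
      diagMinorPhat b = CasoratianValuation.minorPhat b (i + 1) ∧
      diagMinorP b = CasoratianValuation.casoratian b (i + 1) :=
  ⟨(diagMinorQ_eq b hb hd hi hli).trans (minorQ_eq_cv b i),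
    (diagMinorPhat_eq b hb hd hi hli).trans (minorPhat_eq_cv b i),
    (diagMinorP_eq b hb hd hi hli).trans (minorP_eq_casoratian b i)⟩

/-- **On the Brown–Zudilin polytope the diagonal pair's minors are the census's minors in EVERY direction**
`j ∈ [1,7]` (`CasoratianValuation.InPolytope b`: `InBox b`, `2b_j ≤ b₀`, `Σ b_j ≤ 3b₀`). -/
theorem diag_minors_eq_cv_of_inPolytope (b : ℕ → ℤ) (hb : CasoratianValuation.InPolytope b) {j : ℕ}
    (hj : j ∈ Icc 1 7) :
    diagMinorQ b = CasoratianValuation.minorQ b j ∧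
      diagMinorPhat b = CasoratianValuation.minorPhat b j ∧
      diagMinorP b = CasoratianValuation.casoratian b j := by
  obtain ⟨hj1, hj7⟩ := mem_Icc.1 hj
  obtain ⟨i, rfl⟩ : ∃ i, j = i + 1 := ⟨j - 1, by omega⟩
  have hi : i ∈ range 7 := mem_range.2 (by omega)
  have hbox : InBox b := hb.1
  have hd : 0 ≤ dOf b := by have := hb.2.2; unfold dOf; linarith
  have hli : b (i + 1) ≤ b 0 := by
    have h2 := hb.2.1 i hi; have h0 := (hbox.2 i hi).1; linarith
  exact diag_minors_eq_cv b hbox hd hi hli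

/-! ### (DS) for the form itself, and the diagonal eliminant -/

/-- **(DS) for the linear form:** `F̃₇(b⁺) = F̃₇(b + e_{i+1}) − λ_i(b)·F̃₇(b)` — from the three-term decomposition of the
three dual series and (DS) for `U`, `W`, `V`. -/
theorem vwpDual_dsShift (b : ℕ → ℤ) (hb : InBox b) (hd : 0 ≤ dOf b) {i : ℕ} (hi : i ∈ range 7)
    (hli : b (i + 1) ≤ b 0) :
    vwpDual 7 (dsShift b) = vwpDual 7 (up b i) - (dsLam b i : ℝ) * vwpDual 7 b := by
  obtain ⟨hU, hW, hV⟩ := dictionary_dsShift b hb hd hi hli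
  have h0 := (vwp_decomposition b hb (sum_le_of_dOf b hd)).2
  obtain ⟨hbi, hsi⟩ := box_up b hb hd hi hli
  have h1 := (vwp_decomposition (up b i) hbi hsi).2
  have h2 := (vwp_decomposition (dsShift b) (inBox_dsShift hb) (sum_dsShift_le hd)).2
  rw [h2, h1, h0, hU, hW, hV]
  unfold up
  push_cast
  ring

/-- The `ζ(3)`-ELIMINANT of the diagonal pair `(b, b⁺)`: `W(b⁺)·F̃₇(b) − W(b)·F̃₇(b⁺)` (a real number). -/
def diagElim (b : ℕ → ℤ) : ℝ :=
  (coeffW (dsShift b) : ℝ) * vwpDual 7 b - (coeffW b : ℝ) * vwpDual 7 (dsShift b)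

/-- **The diagonal eliminant IS Brown–Zudilin's eliminant:** `diagElim b = partnerElim b i` for every admissible slot
`i` (as real numbers, not merely at the level of rates). -/
theorem diagElim_eq_partnerElim (b : ℕ → ℤ) (hb : InBox b) (hd : 0 ≤ dOf b) {i : ℕ} (hi : i ∈ range 7)
    (hli : b (i + 1) ≤ b 0) : diagElim b = partnerElim b i := by
  obtain ⟨-, hW, -⟩ := dictionary_dsShift b hb hd hi hli
  have hF := vwpDual_dsShift b hb hd hi hli
  unfold diagElim partnerElim
  rw [hF, hW]
  unfold up
  push_cast
  ring

/-- Hence the diagonal eliminant is `ζ(3)`-free with Brown–Zudilin's minors as coefficients: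
`W(b⁺)·F̃₇(b) − W(b)·F̃₇(b⁺) = Q_i(b)·ζ(5) − P_i(b)`. -/
theorem diagElim_eq (b : ℕ → ℤ) (hb : InBox b) (hd : 0 ≤ dOf b) {i : ℕ} (hi : i ∈ range 7)
    (hli : b (i + 1) ≤ b 0) :
    diagElim b = (minorQ b i : ℝ) * zetaValue 5 - (minorP b i : ℝ) := by
  rw [diagElim_eq_partnerElim b hb hd hi hli, partnerElim_eq b hb hd hi hli]

/-- The same with the diagonal pair's own minors: `diagElim b = diagMinorQ b · ζ(5) − diagMinorP b`. -/
theorem diagElim_eq_diagMinors (b : ℕ → ℤ) (hb : InBox b) (hd : 0 ≤ dOf b) {i : ℕ} (hi : i ∈ range 7)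
    (hli : b (i + 1) ≤ b 0) :
    diagElim b = (diagMinorQ b : ℝ) * zetaValue 5 - (diagMinorP b : ℝ) := by
  rw [diagElim_eq b hb hd hi hli, diagMinorQ_eq b hb hd hi hli, diagMinorP_eq b hb hd hi hli]

/-- The same over the census's objects:
`diagElim b = CasoratianValuation.minorQ b (i+1) · ζ(5) − CasoratianValuation.casoratian b (i+1)`. -/
theorem diagElim_eq_cv (b : ℕ → ℤ) (hb : InBox b) (hd : 0 ≤ dOf b) {i : ℕ} (hi : i ∈ range 7)
    (hli : b (i + 1) ≤ b 0) :
    diagElim b = (CasoratianValuation.minorQ b (i + 1) : ℝ) * zetaValue 5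
      - (CasoratianValuation.casoratian b (i + 1) : ℝ) := by
  rw [diagElim_eq_partnerElim b hb hd hi hli, partnerElim_eq_cv b hb hd hi hli]

/-! ### Consecutive-term elimination along the diagonal sequence -/

/-- **Along the diagonal sequence `b, b⁺, b⁺⁺, …` consecutive-term elimination reproduces Brown–Zudilin's eliminant at the
current base point**, for the first `d(b) + 1` steps (`k ≤ d(b)`, so that `d(dsShift^[k] b) = d(b) − k ≥ 0`):
`diagElim (dsShift^[k] b) = partnerElim (dsShift^[k] b) i`. -/
theorem diagElim_iterate_eq_partnerElim (b : ℕ → ℤ) (hb : InBox b) (k : ℕ) (hk : (k : ℤ) ≤ dOf b) {i : ℕ}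
    (hi : i ∈ range 7) (hli : b (i + 1) ≤ b 0) :
    diagElim (dsShift^[k] b) = partnerElim (dsShift^[k] b) i := by
  refine diagElim_eq_partnerElim _ (inBox_iterate_dsShift hb k) ?_ hi ?_
  · rw [dOf_iterate_dsShift]; omega
  · rw [iterate_dsShift_zero, iterate_dsShift_succ]; omega

/-- Packaged: the diagonal pair `(b, b⁺)` IS the contiguous sub-class E0 at `b` — same three minors, same eliminant. -/
theorem diag_pair_is_E0 (b : ℕ → ℤ) (hb : InBox b) (hd : 0 ≤ dOf b) {i : ℕ} (hi : i ∈ range 7)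
    (hli : b (i + 1) ≤ b 0) :
    diagMinorQ b = minorQ b i ∧ diagMinorPhat b = minorPhat b i ∧ diagMinorP b = minorP b i ∧
      diagElim b = partnerElim b i :=
  ⟨diagMinorQ_eq b hb hd hi hli, diagMinorPhat_eq b hb hd hi hli, diagMinorP_eq b hb hd hi hli,
    diagElim_eq_partnerElim b hb hd hi hli⟩

end Summit.KontsevichZagierPeriods.Zeta5Search.Elimination

end
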